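import Summits.BirchSwinnertonDyer.BirchSwinnertonDyer.Theorems.KatoDescentTamePotSupersingularJetchevIrreducibleLocalFactsNamedPrint
import Summits.BirchSwinnertonDyer.BirchSwinnertonDyer.Theorems.Rank1ResidualJetCarrierMultEndForm
import Summits.BirchSwinnertonDyer.BirchSwinnertonDyer.Theorems.Rank1ResidualJetKodairaNeronCyclic
import Summits.BirchSwinnertonDyer.BirchSwinnertonDyer.Theorems.Rank1ResidualJetKolyvaginLocalTermClosed
import Summits.BirchSwinnertonDyer.BirchSwinnertonDyer.Theorems.Rank1ResidualJetTransverseConj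
import Summits.BirchSwinnertonDyer.BirchSwinnertonDyer.Theorems.Rank1ResidualJetTransverseClass
import Summits.BirchSwinnertonDyer.Rank1Residual.JET.RingClassTransverseSelfDualForall
import Literature.NumberTheory.EllipticCurves.Rank1Residual.Predicates
import Literature.NumberTheory.EllipticCurves.ModularityVersionApProofs
import HarnessLib

/-!
# Crux `JetchevIrreducibleReadingByName` (item 20165, shared K8-t′ / K9): the skeleton node `Sig.H63IRowObjectsAddv` FROM NAMED PRINT
# ONLY: `⟸ {h44I, hPT, hGZ}` — no completion-layer kernel gap left. Sequel of p532411 with Gross's Prop. 5.3 (`h53`) STRUCK at the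
# point of use (sign theorem `JetchevIrreducibleReadingSign.sign_conjAct_kolyvaginClass_of_irreducible`, p533295) AND the last gap
# `h49str` (Jetchev Prop. 4.9 proper at the carrier) FED IN FRAME from the displayed `hGZ` by
# `JetchevIrreducibleStringent.localization_kolyvaginClass_mem_stringentFamily_of_GZ31_of_irreducible` (irreducible port of bsd-jet
# pv-1 g7's K-GAP-2 theorem p532810), over `…JetchevIrreducibleLocalFactsNamedPrint`; statement = p532411's minus the binders `h53`,
# `h49str`, conclusion text verbatim (= p526159's); seat `bsd-potss-k9-c4` g9; route-free; `--supports 20165`, helper; nothing booked,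
# no item closed, BSD is not proved by any of this. PROPOSED RE-CUT (20165 v7 / 19941 v6, shared text): S6 ↦ `hPT ∧ hGZ`, with
# `H63IRowObjectsAddv_of h44 hNP := h63IRowObjectsAddv_of_poitouTate_of_GZ31 h44 hNP.1 hNP.2`.
# (The paragraphs below are p532411's module docstring, kept for the discharge table of hloc / h𝒯σ / h𝒯sd / htr / hΦ.)

WHAT IS PROVED. `h63IRowObjectsAddv_of_namedPrint_of_h49str`: the body of `Sig.H63IRowObjectsAddv` (skeleton v4–v6 of crux
20165; conclusion text of `JetchevIrreducibleReadingThm52.h63IRowObjectsAddv_of_closedLocalFacts`, p526159, VERBATIM) from FIVE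
hypotheses only: NAMED PRINT {`h44I` (= the registered stub `stub_prop44Irred`, [McC] Prop. 4.4 read irreducible), `hPT`
(Poitou–Tate for the tree's Selmer structures, ∀ K), `h53` (Gross Prop. 5.3 sign schema), `hGZ` ([GZ86 III (3.1)] receptacle
schema)} + the ONE remaining completion-layer gap `h49str` (Jetchev Prop. 4.9 proper at the places over the conductor; bsd-jet
seat pv-1 g7 holds it). Relative to p526159 (nine hypotheses) the four closed local statements are THEOREMS fed by name,
everything else byte-identical:
* `hloc` := `JET.kolyvaginLocalTerm_of_poitouTate hPT` (p523384, bsd-jet pv-1 g6);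
* `h𝒯σ` := `JET.conjActPlace_mem_transverseFamily_forall` (p523159);
* `h𝒯sd` := `JET.RingClassTransverse.localTransverseFamily_selfDual_forall` (p528308, bsd-jet ty g7) — the GUARDED closure
  (`d_K ≠ −3, −4`, available here as `hD3`, `hD4`; the unguarded closed binder of p526159 is false at `(d_K, p) = (−3, 3)`,
  loc. cit., so this file also REPAIRS that vacuity);
* `htr` ≡ `h49tr` := `JET.kolyvaginClass_mem_transverseKer` (p528943, bsd-jet pv-2 g5; `d_K < −4` from
  `X11b.KolyvaginAssembly.discr_lt_neg_four`);
* `hΦ` := `JET.kodairaNeron_isAddCyclic_forall` (as in p526159).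
PROPOSED RE-CUT for the planner (20165 v7, byte-identical with the 19941 v5 candidate's `stub_thm52NamedPrintGapAtP`): S6 ↦ the
conjunction `hPT ∧ h53 ∧ hGZ ∧ h49str`, with `H63IRowObjectsAddv_of h44 hNP := h63IRowObjectsAddv_of_namedPrint_of_h49str h44 hNP.1
hNP.2.1 hNP.2.2.1 hNP.2.2.2`. HONEST FRAMING: conditional throughout; nothing asserted about any curve; the crux, its stubs and
BSD stay open.

References: [cite: Jetchev2008, Thm. 1.4 / Cor. 1.5, Thm. 5.2 (p. 821), Prop. 5.3, Lemma 5.2, Prop. 4.9, Rem. 6.2]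
[cite: McCallumLMS1991, Prop. 4.4] [cite: GrossLMS1991, §1, §3, Prop. 5.3] [cite: GrossZagier1986, III (3.1)]
[cite: Howard2004HeegnerKolyvagin, Prop. 2.1.7, 2.1.9, Lemma 2.7.3] [cite: MilneADT2006, Ch. I, Thm. 4.10(b)]
[cite: SilvermanAEC2009, VII.5 Prop. 5.1, C.15 (Tate's algorithm table)].
-/


set_option autoImplicit false
-- the Theorems directory repeats the summit name (sibling precedent `KatoDescentPotSupersingularAssembly.lean`)
set_option linter.dupNamespace false

noncomputable section

open scoped Classical Pointwise

open WeierstrassCurve IsDedekindDomain NumberField Field Literature.NumberTheory.EllipticCurves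
  Literature.NumberTheory.EllipticCurves.ModularForms Literature.NumberTheory.EllipticCurves.Jetchev2008
  Literature.NumberTheory.GaloisRepresentations Literature.NumberTheory.GaloisCohomology
  Literature.NumberTheory.GaloisRepresentations.DiscreteGaloisModule
  Summit.BirchSwinnertonDyer.Rank1Residual.X11b Summit.BirchSwinnertonDyer.Rank1Residual.X11b.Three
  Summit.BirchSwinnertonDyer.Rank1Residual.JET
  Summit.BirchSwinnertonDyer.Rank1Residual.JET.SelmerVocabulary Literature.NumberTheory.Automorphic

namespace Summit.BirchSwinnertonDyer.BirchSwinnertonDyer.Theorems.JetchevIrreducibleReadingThm52NamedPrintOnly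

/-- **`Sig.H63IRowObjectsAddv` ⟸ named print {`h44I`, `hPT`, `hGZ`} ONLY** (Gross 5.3 struck: the sign by
`JetchevIrreducibleReadingSign.sign_conjAct_kolyvaginClass_of_irreducible`; the gap `h49str` fed in frame from `hGZ` by
`JetchevIrreducibleStringent.localization_kolyvaginClass_mem_stringentFamily_of_GZ31_of_irreducible`).
p526159's `h63IRowObjectsAddv_of_closedLocalFacts` with `h53`, `h49str` REMOVED and `hloc`, `h𝒯σ`, `h𝒯sd`, `htr` DISCHARGED by `JET.kolyvaginLocalTerm_of_poitouTate`,
`JET.conjActPlace_mem_transverseFamily_forall`, `JET.RingClassTransverse.localTransverseFamily_selfDual_forall` (guarded by the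
conclusion's own `d_K ≠ −3, −4`), `JET.kolyvaginClass_mem_transverseKer`; `Φ_q` cyclic by `JET.kodairaNeron_isAddCyclic_forall`.
Conclusion text verbatim. CONDITIONAL; nothing asserted.
[cite: Jetchev2008, Thm. 5.2 (p. 821), Thm. 1.4, Prop. 4.9] [cite: McCallumLMS1991, §4 Prop. 4.4] [cite: Howard2004HeegnerKolyvagin, Prop. 2.1.9 (ii), Lemma 2.7.3] -/
theorem h63IRowObjectsAddv_of_poitouTate_of_GZ31
    -- NAMED PRINT: [McC] Prop. 4.4 in the irreducible reading (= stub `stub_prop44Irred` of 20165, verbatim)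
    (h44I : ∀ (W : WeierstrassCurve ℚ) [W.IsElliptic] [W.IsGloballyMinimal] [NeZero (W.conductorNorm ℤ)],
        ¬ W.HasCM →
        ∀ (K : Type) [Field K] [NumberField K], IsImaginaryQuadratic K →
        NumberField.discr K ≠ -3 → NumberField.discr K ≠ -4 →
        SatisfiesHeegnerHypothesis (W.conductorNorm ℤ) K →
        ∀ (p : ℕ) [Fact p.Prime], p ≠ 2 → W.HasIrreducibleModPGaloisRep p →
        ∀ (Dt : ModularParametrizationData W (W.conductorNorm ℤ)) (β : ℤ) (ι : K →+* ℂ)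
          (M : ℕ), 1 ≤ M →
        ∀ (m l : ℕ), Squarefree (m * l) → l.Prime → ¬ l ∣ m →
          (∀ l' ∈ (m * l).primeFactors, Zhang2014.IsKolyvaginPrime (W.conductorNorm ℤ) W K p l' ∧
            M ≤ Zhang2014.kolyvaginIndex W p l') →
        ∀ (d : KolyvaginHeegnerData Dt β ι m) (d' : KolyvaginHeegnerData Dt β ι (m * l)),
          (∀ l' ∈ m.primeFactors, ∀ (x : ringClassField K ι m) (x' : ringClassField K ι (m * l)),
            (x : ℂ) = x' → ((d'.σ l' x' : ringClassField K ι (m * l)) : ℂ) = (d.σ l' x : ℂ)) →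
          (∀ s ∈ d.S, ∃ s' ∈ d'.S, ∀ (x : ringClassField K ι m) (x' : ringClassField K ι (m * l)),
            (x : ℂ) = x' → ((s' x' : ringClassField K ι (m * l)) : ℂ) = (s x : ℂ)) →
          (∀ s' ∈ d'.S, ∃ s ∈ d.S, ∀ (x : ringClassField K ι m) (x' : ringClassField K ι (m * l)),
            (x : ℂ) = x' → ((s' x' : ringClassField K ι (m * l)) : ℂ) = (s x : ℂ)) →
          (∀ (x : ringClassField K ι m) (x' : ringClassField K ι (m * l)),
            (x : ℂ) = x' → d'.emb x' = d.emb x) →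
        ∀ (v : HeightOneSpectrum (𝓞 K)), (l : 𝓞 K) ∈ v.asIdeal →
        ∀ (j : ℕ),
          (((p ^ j : ℕ) : ℤ) • d'.kolyvaginClass (Fact.out : p.Prime) M ∈
              selmerLocalKer (W.baseChange K) (v.adicCompletion K) ((p ^ M : ℕ) : ℤ) ↔
            ((p ^ j : ℕ) : ℤ) • d'.kolyvaginClass (Fact.out : p.Prime) M ∈
              (W.baseChange K).torsionLocalKer (v.adicCompletion K) ((p ^ M : ℕ) : ℤ)) ∧
          (((p ^ j : ℕ) : ℤ) • d'.kolyvaginClass (Fact.out : p.Prime) M ∈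
              (W.baseChange K).torsionLocalKer (v.adicCompletion K) ((p ^ M : ℕ) : ℤ) ↔
            ((p ^ j : ℕ) : ℤ) • d.kolyvaginClass (Fact.out : p.Prime) M ∈
              (W.baseChange K).torsionLocalKer (v.adicCompletion K) ((p ^ M : ℕ) : ℤ)))
    -- NAMED PRINT: Poitou–Tate duality for the tree's Selmer structures (named fact, bsd-jet ARM P); Gross Prop. 5.3 is no
    -- longer displayed (the sign is a theorem on the irreducible row), nor is any completion-layer gap
    (hPT : ∀ (K : Type) [Field K] [NumberField K], poitouTate_selmerStructure_duality_conj K)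
    -- [GZ86 III (3.1)] in the receptacle form, CLOSED WITH THE PRINTED GUARDS (Heegner field, odd `p` with `E[p]` irreducible
    -- — so `E(ℚ)[p] = 0` and `n′ := #E(ℚ)_tors` is prime to `p` —, square-free conductors `m` with Zhang–Kolyvagin prime factors,
    -- hence `m ≥ 1` prime to `N`: Gross 1991 §3 «n ≥ 1 … prime to N», read-1's `HGZKolyvagin` body; the unguarded `∀ W p m`
    -- closure of p526159/p528465 is SATISFIABILITY-UNVERIFIED, bsd-jet read-1 ADD-9 ANNEX-5 §2)
    (hGZ : ∀ (W : WeierstrassCurve ℚ) [W.IsElliptic] [W.IsGloballyMinimal] [NeZero (W.conductorNorm ℤ)]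
      (K : Type) [Field K] [NumberField K], IsImaginaryQuadratic K →
      SatisfiesHeegnerHypothesis (W.conductorNorm ℤ) K →
      ∀ (p : ℕ) [Fact p.Prime], p ≠ 2 → W.HasIrreducibleModPGaloisRep p →
      ∀ (Dt : ModularParametrizationData W (W.conductorNorm ℤ)) (β : ℤ) (ι : K →+* ℂ)
      [∀ j : ℕ, NumberField (ringClassField K ι j)],
      ∃ n' : ℤ, IsCoprime (p : ℤ) n' ∧ ∀ (m : ℕ), Squarefree m →
        (∀ q ∈ m.primeFactors, Zhang2014.IsKolyvaginPrime (W.conductorNorm ℤ) W K p q) →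
        ∀ (dm : KolyvaginHeegnerData Dt β ι m)
        (γ : ringClassField K ι m ≃ₐ[ℚ] ringClassField K ι m), γ ∈ ringClassGal ι m →
        ∀ v : HeightOneSpectrum (𝓞 K), ¬ (W.baseChange K).HasGoodReductionAt v →
          n' • pointsMap (W.baseChange K) (v.adicCompletion K)
              (dm.toGeomPoints (pointGalHom W (ringClassField K ι m) γ dm.y)) ∈
            E0Receptacle (W.baseChange K) v ∧
          ∀ (ℓ : ℕ), ℓ ∈ m.primeFactors → ∀ (dm' : KolyvaginHeegnerData Dt β ι (m / ℓ))
            (hle : ringClassField K ι (m / ℓ) ≤ ringClassField K ι m),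
            n' • pointsMap (W.baseChange K) (v.adicCompletion K)
                (dm.toGeomPoints (pointGalHom W (ringClassField K ι m) γ
                  (WeierstrassCurve.Affine.Point.map (W' := W)
                    ((RingClassField.inclusion ι hle).restrictScalars ℚ) dm'.y))) ∈
              E0Receptacle (W.baseChange K) v) :
    -- CONCLUSION: the body of `Sig.H63IRowObjectsAddv` (skeleton v4 of crux 20165), verbatim
    ∀ (W : WeierstrassCurve ℚ) [W.IsElliptic] [W.IsGloballyMinimal] [NeZero (W.conductorNorm ℤ)],
    ¬ W.HasCM → ∀ (K : Type) [Field K] [NumberField K], IsImaginaryQuadratic K →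
    NumberField.discr K ≠ -3 → NumberField.discr K ≠ -4 →
    SatisfiesHeegnerHypothesis (W.conductorNorm ℤ) K →
    ∀ (τ : K ≃ₐ[ℚ] K), τ ≠ 1 →
    ∀ (p : ℕ) [Fact p.Prime], p ≠ 2 → Rank1Residual.Addv W p → 0 ≤ padicValRat p W.j →
    W.HasIrreducibleModPGaloisRep p →
    ¬ p ∣ (W.baseChange ℚ_[p]).localTamagawaNumber ℤ_[p] →
    (∀ (q' : ℕ) [Fact q'.Prime], q' ∣ W.conductorNorm ℤ →
      p ∣ (W.baseChange ℚ_[q']).localTamagawaNumber ℤ_[q'] → ¬ q' ^ 2 ∣ W.conductorNorm ℤ) →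
    ∀ (Dt : ModularParametrizationData W (W.conductorNorm ℤ)) (β : ℤ) (ι : K →+* ℂ)
      [∀ k : ℕ, NumberField (ringClassField K ι k)]
      (d₁ : KolyvaginHeegnerData Dt β ι 1), ¬ IsOfFinAddOrder d₁.derivedPoint →
    ∀ (q : ℕ) [Fact q.Prime], q ∣ W.conductorNorm ℤ → ¬ q ^ 2 ∣ W.conductorNorm ℤ → q ≠ p →
    ∀ (mdiv m : {c : ℕ // Squarefree c ∧ ∀ ℓ ∈ c.primeFactors,
        Zhang2014.IsKolyvaginPrime (W.conductorNorm ℤ) W K p ℓ} → ℕ∞),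
    (∀ c (u : ℕ), (u : ℕ∞) ≤ mdiv c ↔ ∀ d : KolyvaginHeegnerData Dt β ι c.1,
      ∃ Q : (W.baseChange (ringClassField K ι c.1)).toAffine.Point,
        ((p ^ u : ℕ) : ℤ) • Q = d.derivedPoint) →
    (∀ c, m c = if mdiv c < Zhang2014.levelIndex W p c.1 then mdiv c else ⊤) →
    ∀ mInf : ℕ, (∀ c, (mInf : ℕ∞) ≤ m c) →
      (∀ m' : ℕ, ∃ c, (m' : ℕ∞) ≤ Zhang2014.levelIndex W p c.1 ∧ m c = mInf) →
    ∀ (k : ℕ) c, 1 ≤ k → Jetchev2008.IsGlobalCoreVertex W K ι τ p k c.1 → m c = mInf →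
      (k : ℕ∞) + mInf ≤ Zhang2014.levelIndex W p c.1 →
      padicValNat p ((W.baseChange ℚ_[q]).localTamagawaNumber ℤ_[q]) < k → mInf < k →
      padicValNat p ((W.baseChange ℚ_[q]).localTamagawaNumber ℤ_[q]) ≤ mInf := by
  intro W _ _ _ hcm K _ _ hK hD3 hD4 hH τ hτ p _ hp2 hadd _ hirr _ _ Dt β ι _ d₁ _ q _ hq _ _
    mdiv m hmdiv hm mInf _ _ k c hk hcore hmc hkM htk hik
  have hp : p.Prime := Fact.out
  have hD : NumberField.discr K < -4 := KolyvaginAssembly.discr_lt_neg_four hK ⟨hD3, hD4⟩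
  have hpN : p ∣ W.conductorNorm ℤ := (W.dvd_conductorNorm_iff_not_hasGoodReductionAtPrime p).mpr hadd.1
  -- trivial case: `p ∤ c_q`
  by_cases ht0 : padicValNat p ((W.baseChange ℚ_[q]).localTamagawaNumber ℤ_[q]) = 0
  · rw [ht0]; exact Nat.zero_le _
  have hdvd : p ∣ (W.baseChange ℚ_[q]).localTamagawaNumber ℤ_[q] :=
    dvd_of_one_le_padicValNat (Nat.one_le_iff_ne_zero.mpr ht0)
  -- the carrier place `v₀ ∣ q`, split, and the transport of the row data
  obtain ⟨v₀, hv₀, hv₀N, hqv₀⟩ := exists_split_place_of_dvd K hK τ hτ hH q hq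
  obtain ⟨hminK, hminP, hcEq, hc0, hcyc⟩ := carrierRowData_of_split W K q hK τ v₀ hv₀ hqv₀
  haveI := hminK
  haveI := hminP
  haveI := hcyc (kodairaNeron_isAddCyclic_forall W q p hp2 hdvd)
  -- `τ² = 1`
  haveI : Algebra.IsQuadraticExtension ℚ K := ⟨hK.1⟩
  have hτ2 : τ * τ = 1 := by
    have hcard : Nat.card (K ≃ₐ[ℚ] K) = 2 := by rw [IsGalois.card_aut_eq_finrank, hK.1]
    obtain ⟨y, -, hyu⟩ := (Nat.card_eq_two_iff' (1 : K ≃ₐ[ℚ] K)).mp hcard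
    have h1 : τ = y := hyu τ hτ
    have h2 : τ⁻¹ = y := hyu τ⁻¹ (inv_ne_one.mpr hτ)
    rw [mul_eq_one_iff_eq_inv]
    exact h1.trans h2.symm
  -- instances at level `p^k`
  haveI : NeZero (p ^ k) := ⟨pow_ne_zero k hp.ne_zero⟩
  haveI : Finite (geomTorsion (W.baseChange K) ((p ^ k : ℕ) : ℤ)) :=
    finite_geomTorsion_of_neZero (W.baseChange K) (p ^ k)
  have hn : ((p ^ k : ℕ) : ℤ) ≠ 0 := by exact_mod_cast pow_ne_zero k hp.ne_zero
  -- the named-print schemas at this frame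
  obtain ⟨n', hcop', hGZ'⟩ := hGZ W K hK hH p hp2 hirr Dt β ι
  -- Kolyvagin data of the core vertex
  have hc0' : c.1 ≠ 0 := c.2.1.ne_zero
  have hkc : (k : ℕ∞) ≤ Zhang2014.levelIndex W p c.1 := le_trans le_self_add hkM
  have hcK : ∀ ℓ ∈ c.1.primeFactors, Zhang2014.IsKolyvaginPrime (W.conductorNorm ℤ) W K p ℓ ∧
      k ≤ Zhang2014.kolyvaginIndex W p ℓ := fun ℓ hℓ ↦
    ⟨c.2.2 ℓ hℓ, Zhang2014.natCast_le_levelIndex_iff.mp hkc ℓ hℓ⟩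
  -- the exponent over `K_{v₀}` is the exponent over `ℚ_q`
  have hfac : (((W.baseChange K).baseChange (v₀.adicCompletion K)).localTamagawaNumber
      (v₀.adicCompletionIntegers K)).factorization p =
      padicValNat p ((W.baseChange ℚ_[q]).localTamagawaNumber ℤ_[q]) := by
    rw [hcEq, Nat.factorization_def _ hp]
  have htk' : (((W.baseChange K).baseChange (v₀.adicCompletion K)).localTamagawaNumber
      (v₀.adicCompletionIntegers K)).factorization p < k := by rw [hfac]; exact htk
  -- the intrinsic transverse family (for `h49tr` from `htr` at level `cℓ`)
  obtain ⟨𝒯, h𝒯, hT⟩ := exists_localTransverseFamily W ι ((p ^ k : ℕ) : ℤ) hc0'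
  have key := JetchevIrreducibleLocalFactsNamedPrint.tamagawaExponent_le_mInfty_of_localFacts_of_irreducible_namedPrint h44I W
    hcm K hK hD3 hD4 hH
    (hPT K) p hp2 hirr hpN Dt β ι τ hτ hτ2 hcop' hGZ' mdiv m hmdiv hm k hn c hk hcore mInf hmc hkM hik
    v₀ hv₀ hv₀N hc0 htk'
    (fun 𝒯' h𝒯' ↦ conjActPlace_mem_transverseFamily_forall W K hK ι τ hτ p k hp2 c.1 c.2.1 hcK 𝒯' h𝒯')
    (fun 𝒯' h𝒯' e hμ hadd₁ hadd₂ hgal halt hnondeg ↦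
      RingClassTransverse.localTransverseFamily_selfDual_forall W K hK hD3 hD4 ι p k hp2 c.1 c.2.1 hcK 𝒯' h𝒯'
        e hμ hadd₁ hadd₂ hgal halt hnondeg)
    (fun ℓ h1 h2 _ v hv hfix s hs ↦
      kolyvaginLocalTerm_of_poitouTate hPT W K hK τ hτ p k hp2 hk ℓ h1 h2 v hv hfix s hs)
    (fun d ℓ hℓ ↦ kolyvaginClass_mem_transverseKer W hK hD hp2 Dt β ι k c.2.1 hcK d hℓ)
    (fun ℓ h1 h2 h3 d' w hw ↦ by
      -- `h49tr` from `htr` at level `cℓ` through the reconciliation `hT`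
      have hl : ℓ.Prime := h1.1
      have hlc : ¬ ℓ ∣ c.1 := fun h ↦ h3 (Nat.mem_primeFactors.mpr ⟨hl, h, hc0'⟩)
      have hcl : Squarefree (c.1 * ℓ) :=
        (Nat.squarefree_mul ((Nat.Prime.coprime_iff_not_dvd hl).mpr hlc).symm).mpr ⟨c.2.1, hl.squarefree⟩
      have hpf : (c.1 * ℓ).primeFactors = c.1.primeFactors ∪ {ℓ} := by
        rw [Nat.primeFactors_mul hc0' hl.ne_zero, hl.primeFactors]
      have hcKℓ : ∀ l' ∈ (c.1 * ℓ).primeFactors, Zhang2014.IsKolyvaginPrime (W.conductorNorm ℤ) W K p l' ∧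
          k ≤ Zhang2014.kolyvaginIndex W p l' := by
        intro l' hl'
        rw [hpf, Finset.mem_union, Finset.mem_singleton] at hl'
        rcases hl' with h | rfl
        · exact hcK l' h
        · exact ⟨h1, h2⟩
      rw [← h𝒯 w]
      refine (hT _).mpr (fun l' hl' ↦ ?_) w hw
      exact kolyvaginClass_mem_transverseKer W hK hD hp2 Dt β ι k hcl hcKℓ d'
        (by rw [hpf]; exact Finset.mem_union_left _ hl'))
  rw [hfac] at key
  exact key

end Summit.BirchSwinnertonDyer.BirchSwinnertonDyer.Theorems.JetchevIrreducibleReadingThm52NamedPrintOnly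

end
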